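import Summits.Ventures.PercRepro.RankLevelSetTripleMult

/-!
# PercRepro — THE 3-EXCHANGE MULTIPLICITY AT `ν = 3`, PART A: the 3-exchange sets span (p8 g4, S3 §3q)

`proofs/SUBCLAIM-S3-p8.md` §3q. Write `S_e ⊆ I` for the elements of a basis `I` of the rank-`q` set `B` on the
fundamental circuit of `e ∈ B ∖ I` (the SUPPORT of `e`). For `e, w ∈ B ∖ I` and `z ≠ z'` in `I` with `z ∈ S_e`,
`z' ∉ S_e`, `z' ∈ S_w`, the set `(I ∖ {z, z'}) ∪ {e, w}` has `I` in its closure: `z ∈ cl((I ∖ {z, z'}) ∪ {e})`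
because the circuit of `e` avoids `z'`, and `w ∈ cl(I) ∖ cl(I ∖ {z'})` because the circuit of `w` contains `z'`, so
`z' ∈ cl((I ∖ {z'}) ∪ {w})` by the exchange property (`subset_closure_exchange_two`). Hence, when `B ∖ I = {x, y, w}`,
`S_x ∪ S_y = T` has exactly `3` elements and `S_w ⊄ T` (say `z' ∈ S_w ∖ T`), the three sets `(I ∖ {z, z'}) ∪ {x, y, w}`,
`z ∈ T`, are distinct spanning `(q+1)`-subsets of `B`, each missing two elements of `I`
(`exists_three_exchange_family`). Part B (RankLevelSetMultFifteenB) counts the two families of the triple exactly and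
handles the `6`-point plane; RankLevelSetMultFifteen assembles `card_spanF_ge_fifteen`. Axioms: standard.
-/

open scoped Matroid

namespace PercRepro

namespace S2

open Set Finset

variable {α : Type} {M : Matroid α}

open scoped Classical in
/-- **THE 3-EXCHANGE SET SPANS**: for `e, w ∈ cl(I) ∖ I` and `z ≠ z'` in the independent set `I` with `z` on the
fundamental circuit of `e`, `z'` NOT on it, and `z'` on the fundamental circuit of `w`, the set `(I ∖ {z, z'}) ∪ {e, w}`
has `I` in its closure: `z ∈ cl((I ∖ {z, z'}) ∪ {e})` (the circuit of `e` avoids `z'`), and `w ∈ cl(I) ∖ cl(I ∖ {z'})`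
(the circuit of `w` contains `z'`) gives `z' ∈ cl((I ∖ {z'}) ∪ {w})` by the exchange property. -/
theorem subset_closure_exchange_two [M.Finite] {I : Finset α} (hI : M.Indep (I : Set α))
    {e w z z' : α} (hecl : e ∈ M.closure (I : Set α)) (heI : e ∉ I)
    (hwcl : w ∈ M.closure (I : Set α)) (hwI : w ∉ I)
    (hzI : z ∈ I) (hz'I : z' ∈ I) (hzz' : z ≠ z')
    (hze : z ∈ M.fundCircuit e (I : Set α)) (hz'e : z' ∉ M.fundCircuit e (I : Set α))
    (hz'w : z' ∈ M.fundCircuit w (I : Set α)) :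
    (I : Set α) ⊆ M.closure (insert e (insert w (((I.erase z).erase z' : Finset α) : Set α))) := by
  classical
  set J : Finset α := (I.erase z).erase z' with hJ
  have hJmem : ∀ a, a ∈ J ↔ a ∈ I ∧ a ≠ z ∧ a ≠ z' := by
    intro a
    rw [hJ, Finset.mem_erase, Finset.mem_erase]
    tauto
  have hIE : (I : Set α) ⊆ M.E := hI.subset_ground
  have heE : e ∈ M.E := M.mem_ground_of_mem_closure hecl
  have hwE : w ∈ M.E := M.mem_ground_of_mem_closure hwcl
  have hDE : insert e (insert w ((J : Finset α) : Set α)) ⊆ M.E := by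
    intro a ha
    rcases ha with rfl | rfl | haJ
    · exact heE
    · exact hwE
    · exact hIE (by exact_mod_cast ((hJmem a).1 (by exact_mod_cast haJ)).1)
  -- (1) `z ∈ cl(J ∪ {e})`
  have hC : M.IsCircuit (M.fundCircuit e (I : Set α)) := hI.fundCircuit_isCircuit hecl (by simpa using heI)
  have hz1 : z ∈ M.closure (M.fundCircuit e (I : Set α) \ {z}) := hC.mem_closure_sdiff_singleton_of_mem hze
  have hsub1 : M.fundCircuit e (I : Set α) \ {z} ⊆ insert e (insert w ((J : Finset α) : Set α)) := by
    intro a ha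
    have haC : a ∈ M.fundCircuit e (I : Set α) := ha.1
    have haz : a ≠ z := by simpa using ha.2
    have haz' : a ≠ z' := by
      rintro rfl
      exact hz'e haC
    rcases M.fundCircuit_subset_insert e (I : Set α) haC with rfl | haI
    · exact Set.mem_insert _ _
    · refine Set.mem_insert_of_mem _ (Set.mem_insert_of_mem _ ?_)
      rw [Finset.mem_coe, hJmem]
      exact ⟨by exact_mod_cast haI, haz, haz'⟩
  have hz2 : z ∈ M.closure (insert e (insert w ((J : Finset α) : Set α))) :=
    M.closure_subset_closure hsub1 hz1
  -- (2) `w ∉ cl(I ∖ {z'})`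
  have hwz' : w ≠ z' := by
    rintro rfl
    exact hwI hz'I
  have hind : M.Indep (insert w (I : Set α) \ {z'}) :=
    (hI.mem_fundCircuit_iff hwcl (by simpa using hwI)).1 hz'w
  have hind' : M.Indep (insert w ((I : Set α) \ {z'})) := by
    rwa [Set.insert_sdiff_singleton_comm hwz']
  have hIz'ind : M.Indep ((I : Set α) \ {z'}) := hI.subset Set.sdiff_subset
  have hwnot : w ∉ M.closure ((I : Set α) \ {z'}) := by
    have hwnotmem : w ∉ (I : Set α) \ {z'} := fun h => hwI (by exact_mod_cast h.1)
    exact ((hIz'ind.insert_indep_iff_of_notMem hwnotmem).1 hind').2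
  -- (3) the exchange: `z' ∈ cl((I ∖ {z'}) ∪ {w})`
  have hIeq : insert z' ((I : Set α) \ {z'}) = (I : Set α) := by
    rw [Set.insert_sdiff_singleton, Set.insert_eq_of_mem (by exact_mod_cast hz'I)]
  have hwin : w ∈ M.closure (insert z' ((I : Set α) \ {z'})) \ M.closure ((I : Set α) \ {z'}) := by
    refine ⟨?_, hwnot⟩
    rw [hIeq]; exact hwcl
  have hz'3 : z' ∈ M.closure (insert w ((I : Set α) \ {z'})) := (M.closure_exchange hwin).1
  -- (4) `I ∖ {z'} = J ∪ {z}`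
  have hIz' : (I : Set α) \ {z'} = insert z ((J : Finset α) : Set α) := by
    ext a
    simp only [Set.mem_sdiff, Set.mem_singleton_iff, Set.mem_insert_iff, Finset.mem_coe, hJmem]
    constructor
    · rintro ⟨haI, haz'⟩
      by_cases haz : a = z
      · exact Or.inl haz
      · exact Or.inr ⟨haI, haz, haz'⟩
    · rintro (rfl | ⟨haI, -, haz'⟩)
      · exact ⟨hzI, hzz'⟩
      · exact ⟨haI, haz'⟩
  -- (5) conclude
  have hsubD : insert w (insert z ((J : Finset α) : Set α)) ⊆
      M.closure (insert e (insert w ((J : Finset α) : Set α))) := by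
    intro a ha
    rcases ha with rfl | rfl | haJ
    · exact M.mem_closure_of_mem (Set.mem_insert_of_mem _ (Set.mem_insert _ _)) hDE
    · exact hz2
    · exact M.mem_closure_of_mem (Set.mem_insert_of_mem _ (Set.mem_insert_of_mem _ haJ)) hDE
  intro a haI
  by_cases haz : a = z
  · rw [haz]; exact hz2
  by_cases haz' : a = z'
  · rw [haz']
    refine M.closure_subset_closure_of_subset_closure hsubD ?_
    rw [← hIz']; exact hz'3
  · refine M.mem_closure_of_mem (Set.mem_insert_of_mem _ (Set.mem_insert_of_mem _ ?_)) hDE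
    rw [Finset.mem_coe, hJmem]
    exact ⟨by exact_mod_cast haI, haz, haz'⟩

open scoped Classical in
/-- **THE 3-EXCHANGE FAMILY**: `I` a basis of the rank-`q` set `B` with `B ∖ I = {x, y, w}`; if the fundamental
circuits of `x` and `y` meet `I` in a set `T` of `≤ 3` (hence exactly `3`) elements and the circuit of `w` meets `I`
outside `T`, say at `z'`, then the three sets `(I ∖ {z, z'}) ∪ {x, y, w}`, `z ∈ T`, are distinct spanning
`(q+1)`-subsets of `B`, each missing two elements of `I`. -/
theorem exists_three_exchange_family [M.Finite] (q : ℕ) (hcirc : ∀ C, M.IsCircuit C → 3 ≤ C.encard)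
    (hline : ∀ L ⊆ M.E, M.eRk L = 2 → L.ncard ≤ 3)
    {B : Finset α} (hBq : M.eRk (B : Set α) = (q : ℕ∞))
    {I : Finset α} (hIind : M.Indep (I : Set α)) (hIB : I ⊆ B) (hIcard : I.card = q)
    (hBcl : (B : Set α) ⊆ M.closure (I : Set α))
    {x y w : α} (hxy : x ≠ y) (hxw : x ≠ w) (hyw : y ≠ w) (hXeq : B \ I = {x, y, w})
    (hT : (I.filter (fun z => z ∈ M.fundCircuit x (I : Set α)) ∪
      I.filter (fun z => z ∈ M.fundCircuit y (I : Set α))).card ≤ 3)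
    (hw : ¬ I.filter (fun z => z ∈ M.fundCircuit w (I : Set α)) ⊆
      I.filter (fun z => z ∈ M.fundCircuit x (I : Set α)) ∪ I.filter (fun z => z ∈ M.fundCircuit y (I : Set α))) :
    ∃ F : Finset (Set α), F.card = 3 ∧ F ⊆ spanF M q B ∧
      ∀ D ∈ F, ∃ z ∈ I, ∃ z' ∈ I, z ≠ z' ∧ z ∉ D ∧ z' ∉ D := by
  classical
  set X : Finset α := B \ I with hXdef
  set T : Finset α := I.filter (fun z => z ∈ M.fundCircuit x (I : Set α)) ∪
    I.filter (fun z => z ∈ M.fundCircuit y (I : Set α)) with hTdef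
  have hXI : ∀ a ∈ X, a ∉ I := fun a ha => (Finset.mem_sdiff.1 ha).2
  have hXB : ∀ a ∈ X, a ∈ B := fun a ha => (Finset.mem_sdiff.1 ha).1
  have hXcl : ∀ a ∈ X, a ∈ M.closure (I : Set α) := fun a ha => hBcl (by exact_mod_cast hXB a ha)
  have hxX : x ∈ X := by rw [hXeq]; simp
  have hyX : y ∈ X := by rw [hXeq]; simp
  have hwX : w ∈ X := by rw [hXeq]; simp
  have hXcard : X.card = 3 := by
    rw [hXeq]
    exact Finset.card_eq_three.2 ⟨x, y, w, hxy, hxw, hyw, rfl⟩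
  have hTI : T ⊆ I := Finset.union_subset (Finset.filter_subset _ _) (Finset.filter_subset _ _)
  have hT3 : T.card = 3 := by
    have h3 := three_le_card_filter_fundCircuit_pair hcirc hline hIind (hXcl x hxX) (hXI x hxX)
      (hXcl y hyX) (hXI y hyX) hxy
    rw [Finset.filter_or] at h3
    change 3 ≤ T.card at h3
    omega
  have hq3 : 3 ≤ q := by rw [← hIcard, ← hT3]; exact Finset.card_le_card hTI
  obtain ⟨z', hz'w, hz'T⟩ := Finset.not_subset.1 hw
  have hz'I : z' ∈ I := (Finset.mem_filter.1 hz'w).1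
  have hz'C : z' ∈ M.fundCircuit w (I : Set α) := (Finset.mem_filter.1 hz'w).2
  set f : α → Set α := fun z => ((((I.erase z).erase z') ∪ X : Finset α) : Set α) with hf
  refine ⟨T.image f, ?_, ?_, ?_⟩
  · -- three distinct sets
    rw [← hT3]
    apply Finset.card_image_of_injOn
    intro z hz z₁ hz₁ hzz₁
    have hz₁T : z₁ ∈ T := by exact_mod_cast hz₁
    have hzT : z ∈ T := by exact_mod_cast hz
    have hz₁I : z₁ ∈ I := hTI hz₁T
    have heq : (((I.erase z).erase z') ∪ X : Finset α) = ((I.erase z₁).erase z') ∪ X := by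
      have := hzz₁
      simp only [hf] at this
      exact_mod_cast this
    have hz₁notmem : z₁ ∉ ((I.erase z₁).erase z') ∪ X := by
      rw [Finset.mem_union, Finset.mem_erase, Finset.mem_erase]
      rintro (⟨-, h, -⟩ | h)
      · exact h rfl
      · exact hXI z₁ h hz₁I
    rw [← heq, Finset.mem_union, Finset.mem_erase, Finset.mem_erase] at hz₁notmem
    by_contra hne
    apply hz₁notmem
    left
    refine ⟨?_, Ne.symm hne, hz₁I⟩
    rintro rfl
    exact hz'T hz₁T
  · -- every set spans
    intro D hD
    rw [Finset.mem_image] at hD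
    obtain ⟨z, hzT, rfl⟩ := hD
    have hzI : z ∈ I := hTI hzT
    have hzz' : z ≠ z' := by
      rintro rfl
      exact hz'T hzT
    -- the element `e ∈ {x, y}` whose circuit carries `z`
    have hexists : ∃ e ∈ X, z ∈ M.fundCircuit e (I : Set α) ∧ z' ∉ M.fundCircuit e (I : Set α) := by
      rw [hTdef, Finset.mem_union, Finset.mem_filter, Finset.mem_filter] at hzT
      rw [hTdef, Finset.mem_union, Finset.mem_filter, Finset.mem_filter] at hz'T
      push Not at hz'T
      rcases hzT with ⟨-, hzx⟩ | ⟨-, hzy⟩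
      · exact ⟨x, hxX, hzx, hz'T.1 hz'I⟩
      · exact ⟨y, hyX, hzy, hz'T.2 hz'I⟩
    obtain ⟨e, heX, hze, hz'e⟩ := hexists
    have hsub := subset_closure_exchange_two hIind (hXcl e heX) (hXI e heX) (hXcl w hwX) (hXI w hwX)
      hzI hz'I hzz' hze hz'e hz'C
    have hsubD : insert e (insert w (((I.erase z).erase z' : Finset α) : Set α)) ⊆
        ((((I.erase z).erase z') ∪ X : Finset α) : Set α) := by
      intro a ha
      rw [Finset.coe_union, Set.mem_union]
      rcases ha with rfl | rfl | haJ
      · exact Or.inr (by exact_mod_cast heX)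
      · exact Or.inr (by exact_mod_cast hwX)
      · exact Or.inl haJ
    have hIcl : (I : Set α) ⊆ M.closure ((((I.erase z).erase z') ∪ X : Finset α) : Set α) :=
      hsub.trans (M.closure_subset_closure hsubD)
    have hcl : (B : Set α) ⊆ M.closure ((((I.erase z).erase z') ∪ X : Finset α) : Set α) :=
      hBcl.trans (M.closure_subset_closure_of_subset_closure hIcl)
    have hsubB : ((I.erase z).erase z') ∪ X ⊆ B :=
      Finset.union_subset (((Finset.erase_subset _ _).trans (Finset.erase_subset _ _)).trans hIB)
        Finset.sdiff_subset
    rw [mem_spanF]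
    refine ⟨((I.erase z).erase z') ∪ X, hsubB, ?_, ?_, hcl, rfl⟩
    · have hdisj : Disjoint ((I.erase z).erase z') X := by
        rw [Finset.disjoint_left]
        intro a ha haX
        exact hXI a haX (Finset.mem_erase.1 (Finset.mem_erase.1 ha).2).2
      rw [Finset.card_union_of_disjoint hdisj, hXcard, Finset.card_erase_of_mem, Finset.card_erase_of_mem hzI,
        hIcard]
      · omega
      · exact Finset.mem_erase.2 ⟨hzz'.symm, hz'I⟩
    · exact eRk_eq_of_subset_of_subset_closure (by exact_mod_cast hsubB) hBq hcl
  · -- each set misses `z` and `z'`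
    intro D hD
    rw [Finset.mem_image] at hD
    obtain ⟨z, hzT, rfl⟩ := hD
    have hzI : z ∈ I := hTI hzT
    have hzz' : z ≠ z' := by
      rintro rfl
      exact hz'T hzT
    refine ⟨z, hzI, z', hz'I, hzz', ?_, ?_⟩
    · simp only [hf, Finset.coe_union, Set.mem_union, Finset.mem_coe, Finset.mem_erase, not_or]
      exact ⟨fun h => h.2.1 rfl, fun h => hXI z h hzI⟩
    · simp only [hf, Finset.coe_union, Set.mem_union, Finset.mem_coe, Finset.mem_erase, not_or]
      exact ⟨fun h => h.1 rfl, fun h => hXI z' h hz'I⟩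

end S2

end PercRepro
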